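import Literature.NumberTheory.EllipticCurves.Kato2004.DivisibilityInputsContragredient
import Literature.NumberTheory.EllipticCurves.Kato2004.DivisibilityInputsExceptionalTransportLengthProofs
import HarnessLib

/-!
# PRINT-EXACT twins (dual Selmer datum of key `γ⁻¹`, structure `Kato2004.MultDivisibilityInputsContra`) of
# `DivisibilityInputsExceptionalTransportProofs` / `…LengthProofs`: Conj. 17.6's inequality `ℓ_𝔮(X) ≤ ord_𝔮(L̃₀)`
# OFF the factor's prime from a package for `L = ι(π)·L₀`, and AT it by transport — PROVED module theory

K. Kato, Astérisque **295** (2004) [Kato2004Asterisque], Thm. 12.5 (3) with (12.5.1) (p. 222), §17.13 (pp. 279–280).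
The cell `bsd-cited` ARM-P register (flag `Kato-1713-dual-action`, file `DivisibilityInputsContragredient`) keys the PRINT-
EXACT §17.13 packages to a dual Selmer datum `D : W.SelmerDualData κ γ⁻¹` (the contragredient `Λ`-structure for which
(17.13.1) is `Λ`-linear against the covariant `I : IwasawaH1Data W p κ γ`). This file repeats, FIELD FOR FIELD, the three
theorems of the key-`γ` files for that structure — `MultDivisibilityInputsContra.lengthAt_X_le_off_factor`,
`…lengthAt_X_le_at_factor_of_transport`, `…lengthAt_X_le_at_factor_of_lengthAt_symm` — with ONE change of interface: the
finite generation of `D.X` is an instance HYPOTHESIS (for a key-`γ⁻¹` datum the tree's `SelmerDualData.module_finite_of_isCyclotomic`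
does not apply verbatim; it follows from the `ι`-twist of the key-`γ` datum once the twist lemma is in the tree). The proofs
are the key-`γ` proofs verbatim (the module theory does not see the key). THEOREMS ONLY (no definition, no named fact, no
instance, no `sorry`); `Kato2004.thm12_4` is a hypothesis.

Motivation (cell `bsd-2adic`, seat `addL2x` GEN 16, crux stmt-BirchSwinnertonDyer-19098, pen RC-364 (1) AP4): the print-exact
home of the odd-branch typed input of T20 has the exceptional prime at Kato's natural `(5T + 4) = (γ − κ(γ)⁻¹)`.

References: [Kato2004Asterisque] Thm. 12.4 (2) (p. 221), Thm. 12.5 (3) and (12.5.1) (p. 222), Conj. 17.6 (p. 274), §17.3 (p. 273),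
§17.13 (pp. 279–280); [Greenberg1989] pp. 101–102 (`S^ι`); [GreenbergLNM1716] Thm. 1.14 (p. 68); [MazurTateTeitelbaum1986Invent] §I.17.
-/

noncomputable section

open scoped Classical

namespace Literature.NumberTheory.EllipticCurves.Kato2004

open Module Field Literature.NumberTheory.EllipticCurves.IwasawaAlgebra
  Literature.NumberTheory.EllipticCurves.Module

variable {W : WeierstrassCurve ℚ} [W.IsElliptic] {p : ℕ} [Fact p.Prime]
  [ContinuousSMul ℤ_[p] (W.tateModule p)] {κ : ZpExtension ℚ p} {γ : absoluteGaloisGroup ℚ}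
  {I : IwasawaH1Data W p κ γ} {D : W.SelmerDualData κ γ⁻¹}

/-- `G ≠ 0` in a print-exact package for a non-zero `L` (twin of `MultDivisibilityInputs.G_ne_zero`).
[cite: Kato2004Asterisque, Thm. 16.2 (p. 269) (L ∈ Λ ⊗ ℚ)] -/
theorem MultDivisibilityInputsContra.G_ne_zero {L : PowerSeries ℚ_[p]}
    (K : MultDivisibilityInputsContra W p L κ γ I D) (hL : L ≠ 0) : K.G ≠ 0 := by
  intro hG0
  have hpn : PowerSeries.C ((p : ℚ_[p]) ^ K.n) ≠ 0 := by
    rw [Ne, map_eq_zero_iff _ (PowerSeries.C_injective), pow_eq_zero_iff']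
    exact fun h => (Nat.cast_ne_zero.mpr (Fact.out : p.Prime).ne_zero) h.1
  have h := K.ιG_eq
  rw [hG0, map_zero, eq_comm, mul_eq_zero] at h
  exact h.elim hpn hL

/-- **`ℓ_𝔮(X) ≤ ℓ_𝔮(Λ/(L̃₀))` OFF the factor `π`.** Package `K : MultDivisibilityInputs W p (ι(π)·L₀) κ γ I D`
(so `ι K.G = pⁿ·ι(π)·L₀`), an integral `L̃₀ ≠ 0` with `ι L̃₀ = p^m·L₀`, Kato's Thm. 12.4 (2) (`thm12_4`) for
the binders of `I.H`; then at every height-one `𝔮 ∌ p` with `π ∉ 𝔮`: `ℓ_𝔮(D.X) ≤ ℓ_𝔮(Λ/(L̃₀))`. Proof: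
`Kato2004.lengthAt_add_le_of_skeleton_exceptional` (with `J = ⊤`: the local term of Thm. 12.5 (3) cancels
against `upTo_H2loc`) gives `ℓ_𝔮(X) ≤ ℓ_𝔮(Λ/(G))`, and `p^m·G = pⁿ·π·L̃₀` in `Λ` (apply `ι`, injective) with
`ℓ_𝔮(Λ/(p^k)) = ℓ_𝔮(Λ/(π)) = 0`. [cite: Kato2004Asterisque, Thm. 12.5 (3) (p. 222), §17.13 (pp. 279–280), 14.9 (p. 239)] -/
theorem MultDivisibilityInputsContra.lengthAt_X_le_off_factor (h12 : thm12_4) (hκ : κ.IsCyclotomic)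
    (hγ : κ.IsTopGenerator γ) {π : IwasawaAlgebra p} {L₀ : PowerSeries ℚ_[p]}
    (K : MultDivisibilityInputsContra W p (iwasawaToPowerSeries p π * L₀) κ γ I D)
    {Lt : IwasawaAlgebra p} {m : ℕ}
    (hLt : iwasawaToPowerSeries p Lt = PowerSeries.C ((p : ℚ_[p]) ^ m) * L₀) (hLt0 : Lt ≠ 0)
    (𝔮 : PrimeSpectrum (IwasawaAlgebra p)) (h𝔮 : 𝔮.asIdeal.height = 1)
    (hp𝔮 : PowerSeries.C (p : ℤ_[p]) ∉ 𝔮.asIdeal) (hπ𝔮 : π ∉ 𝔮.asIdeal) :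
    lengthAt (IwasawaAlgebra p) D.X 𝔮 ≤
      lengthAt (IwasawaAlgebra p) (IwasawaAlgebra p ⧸ Ideal.span {Lt}) 𝔮 := by
  obtain ⟨htf, hrank⟩ := h12.isTorsionFree_and_rank_le_one W p hκ hγ I
  haveI := htf
  obtain ⟨hc0, hc⟩ := natCast_pow_ne_zero_and_not_mem p K.a
  have hπ0 : π ≠ 0 := fun h => hπ𝔮 (h ▸ 𝔮.asIdeal.zero_mem)
  have hιπ0 : iwasawaToPowerSeries p π ≠ 0 := fun h =>
    hπ0 (iwasawaToPowerSeries_injective p (by rw [h, map_zero]))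
  have hL₀0 : L₀ ≠ 0 := by
    intro h0
    apply hLt0
    apply iwasawaToPowerSeries_injective p
    rw [hLt, h0, mul_zero, map_zero]
  have hL : iwasawaToPowerSeries p π * L₀ ≠ 0 := mul_ne_zero hιπ0 hL₀0
  have hG : K.G ≠ 0 := K.G_ne_zero hL
  have hfin : lengthAt (IwasawaAlgebra p) K.H2loc 𝔮 ≠ ⊤ :=
    ne_top_of_le_ne_top (by simp) (K.lengthAt_H2loc_le_one 𝔮 h𝔮 hp𝔮)
  -- the §17.13 bound with the local term absorbed: `ℓ(X) + ℓ(Λ/⊤) ≤ ℓ(Λ/(G))`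
  have hA := lengthAt_add_le_of_skeleton_exceptional hrank K.loc K.toX K.δ K.ε K.upTo_P K.upTo_X
    K.upTo_H2 K.upTo_H2loc K.col K.col_injective (J := ⊤) (fun _ => Submodule.mem_top) K.Z hG
    K.pow_mem 𝔮 (hc 𝔮 h𝔮 hp𝔮) hfin (K.es_bound 𝔮 h𝔮 hp𝔮)
  have hXG : lengthAt (IwasawaAlgebra p) D.X 𝔮 ≤
      lengthAt (IwasawaAlgebra p) (IwasawaAlgebra p ⧸ Ideal.span {K.G}) 𝔮 :=
    le_trans le_self_add hA
  -- `p^m · G = p^n · π · L̃₀` in `Λ`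
  have key : PowerSeries.C ((p : ℤ_[p]) ^ m) * K.G =
      PowerSeries.C ((p : ℤ_[p]) ^ K.n) * (π * Lt) := by
    apply iwasawaToPowerSeries_injective p
    rw [map_mul, map_mul, map_mul, K.ιG_eq, hLt]
    simp only [iwasawaToPowerSeries, map_pow, map_natCast]
    ring
  have hLen : lengthAt (IwasawaAlgebra p) (IwasawaAlgebra p ⧸ Ideal.span {K.G}) 𝔮 =
      lengthAt (IwasawaAlgebra p) (IwasawaAlgebra p ⧸ Ideal.span {Lt}) 𝔮 := by
    rw [← lengthAt_quotient_span_C_pow_mul (m := m) K.G 𝔮 h𝔮 hp𝔮, key,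
      lengthAt_quotient_span_C_pow_mul (m := K.n) (π * Lt) 𝔮 h𝔮 hp𝔮,
      lengthAt_quotient_span_singleton_mul Lt hπ0 𝔮,
      lengthAt_quotient_eq_zero_of_not_le (by rwa [Ideal.span_singleton_le_iff_mem]), zero_add]
  exact hLen ▸ hXG

/-- **`ℓ_{𝔮₀}(X) ≤ ℓ_{𝔮₀}(Λ/(L̃₀))` AT the factor's prime, by TRANSPORT.** Same package data; `𝔮₀ ∌ p` of
height one such that `π ∉ ι𝔮₀` (e.g. `𝔮₀ = (π)` with `(π) ≠ ι(π)`: the exceptional prime of (12.5.1),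
`π = T + 4/5`, `ι(π) ≐ T − 4`), and the two symmetries `ι(char X) = char X` (Greenberg LNM 1716 Thm. 1.14 in
ideal form — for the additive curve of the cell obtained from the theorem over `ℚ(i)` and over `ℚ` for the
twist, tree facts `Greenberg1999.thm114_charIdeal_iota_invariant_splitMult_baseChange` /
`Greenberg1999_thm114_charIdeal_iota_invariant`) and `(ι L̃₀) = (L̃₀)` (functional equation, MTT §I.17). Then
Conj. 17.6's inequality holds at `𝔮₀` SHARP — the package alone gives it only up to the length `1` of
`Λ/(π)` there. Proof: the previous theorem at `ι𝔮₀` and `Kato2004.lengthAt_eq_comap_invol_of_map_invol_charIdeal_eq`,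
`Kato2004.lengthAt_quotient_span_eq_comap_invol_of_map_invol_span_eq`.
[cite: Kato2004Asterisque, Thm. 12.5 (3) and (12.5.1) (p. 222), Conj. 17.6 (p. 274), §17.13 (pp. 279–280)]
[cite: GreenbergLNM1716, Thm. 1.14 (p. 68)] [cite: MazurTateTeitelbaum1986Invent, §I.17] -/
theorem MultDivisibilityInputsContra.lengthAt_X_le_at_factor_of_transport [Module.Finite (IwasawaAlgebra p) D.X]
    (h12 : thm12_4)
    (hκ : κ.IsCyclotomic) (hγ : κ.IsTopGenerator γ) {π : IwasawaAlgebra p} {L₀ : PowerSeries ℚ_[p]}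
    (K : MultDivisibilityInputsContra W p (iwasawaToPowerSeries p π * L₀) κ γ I D)
    {Lt : IwasawaAlgebra p} {m : ℕ}
    (hLt : iwasawaToPowerSeries p Lt = PowerSeries.C ((p : ℚ_[p]) ^ m) * L₀) (hLt0 : Lt ≠ 0)
    (𝔮₀ : PrimeSpectrum (IwasawaAlgebra p)) (h𝔮₀ : 𝔮₀.asIdeal.height = 1)
    (hp𝔮₀ : PowerSeries.C (p : ℤ_[p]) ∉ 𝔮₀.asIdeal)
    (hπ : π ∉ (PrimeSpectrum.comap (invol p).toRingHom 𝔮₀).asIdeal)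
    (hXι : (charIdeal (IwasawaAlgebra p) D.X).map (invol p).toRingHom =
      charIdeal (IwasawaAlgebra p) D.X)
    (hLtι : (Ideal.span {Lt}).map (invol p).toRingHom = Ideal.span {Lt}) :
    lengthAt (IwasawaAlgebra p) D.X 𝔮₀ ≤
      lengthAt (IwasawaAlgebra p) (IwasawaAlgebra p ⧸ Ideal.span {Lt}) 𝔮₀ := by
  set 𝔮' := PrimeSpectrum.comap (invol p).toRingHom 𝔮₀ with h𝔮'def
  have h𝔮' : 𝔮'.asIdeal.height = 1 := by rw [h𝔮'def, height_comap_invol]; exact h𝔮₀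
  have hp𝔮' : PowerSeries.C (p : ℤ_[p]) ∉ 𝔮'.asIdeal := by
    intro h
    apply hp𝔮₀
    rw [h𝔮'def, PrimeSpectrum.comap_asIdeal, Ideal.mem_comap] at h
    change invol p (PowerSeries.C (p : ℤ_[p])) ∈ 𝔮₀.asIdeal at h
    rwa [invol_C] at h
  have hA := K.lengthAt_X_le_off_factor h12 hκ hγ hLt hLt0 𝔮' h𝔮' hp𝔮' hπ
  -- `X` is torsion (from the package), so Greenberg's symmetry can be read prime by prime
  obtain ⟨htf, hrank⟩ := h12.isTorsionFree_and_rank_le_one W p hκ hγ I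
  haveI := htf
  obtain ⟨hc0, -⟩ := natCast_pow_ne_zero_and_not_mem p K.a
  have hπ0 : π ≠ 0 := fun h => hπ (h ▸ 𝔮'.asIdeal.zero_mem)
  have hιπ0 : iwasawaToPowerSeries p π ≠ 0 := fun h =>
    hπ0 (iwasawaToPowerSeries_injective p (by rw [h, map_zero]))
  have hL₀0 : L₀ ≠ 0 := by
    intro h0
    apply hLt0
    apply iwasawaToPowerSeries_injective p
    rw [hLt, h0, mul_zero, map_zero]
  have hG : K.G ≠ 0 := K.G_ne_zero (mul_ne_zero hιπ0 hL₀0)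
  obtain ⟨z, -, hz⟩ := Submodule.mem_map.mp K.pow_mem
  simp only [LinearMap.coe_comp, Function.comp_apply] at hz
  have hXtors : Module.IsTorsion (IwasawaAlgebra p) D.X :=
    isTorsion_of_skeleton_upTo hc0 K.loc K.toX K.δ K.upTo_P K.upTo_X K.col K.col_injective hG hz
      K.isTorsion_H2
  rw [lengthAt_eq_comap_invol_of_map_invol_charIdeal_eq hXtors hXι 𝔮₀ h𝔮₀,
    lengthAt_quotient_span_eq_comap_invol_of_map_invol_span_eq hLtι 𝔮₀]
  exact hA

/-- **`ℓ_{𝔮₀}(X) ≤ ℓ_{𝔮₀}(Λ/(L̃₀))` AT the factor's prime, LENGTH form of the transport hypothesis.** Package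
`K : MultDivisibilityInputs W p (ι(π)·L₀) κ γ I D`, integral `L̃₀ ≠ 0` with `ι L̃₀ = p^m·L₀`, `thm12_4`; a height-one
`𝔮₀ ∌ p` with `π ∉ ι𝔮₀`; the symmetry `ℓ_{𝔮₀}(D.X) = ℓ_{ι𝔮₀}(D.X)` of the one pair of lengths; and
`(ι L̃₀) = (L̃₀)` (functional equation). Then Conj. 17.6's inequality holds at `𝔮₀`. (Same proof as
`lengthAt_X_le_at_factor_of_transport`, with the prime-by-prime reading of Greenberg's theorem replaced by the
hypothesis.) [cite: Kato2004Asterisque, Thm. 12.5 (3) and (12.5.1) (p. 222), Conj. 17.6 (p. 274), §17.13 (pp. 279–280)]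
[cite: GreenbergLNM1716, Thm. 1.14 (p. 68)] [cite: MazurTateTeitelbaum1986Invent, §I.17] -/
theorem MultDivisibilityInputsContra.lengthAt_X_le_at_factor_of_lengthAt_symm (h12 : thm12_4)
    (hκ : κ.IsCyclotomic) (hγ : κ.IsTopGenerator γ) {π : IwasawaAlgebra p} {L₀ : PowerSeries ℚ_[p]}
    (K : MultDivisibilityInputsContra W p (iwasawaToPowerSeries p π * L₀) κ γ I D)
    {Lt : IwasawaAlgebra p} {m : ℕ}
    (hLt : iwasawaToPowerSeries p Lt = PowerSeries.C ((p : ℚ_[p]) ^ m) * L₀) (hLt0 : Lt ≠ 0)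
    (𝔮₀ : PrimeSpectrum (IwasawaAlgebra p)) (h𝔮₀ : 𝔮₀.asIdeal.height = 1)
    (hp𝔮₀ : PowerSeries.C (p : ℤ_[p]) ∉ 𝔮₀.asIdeal)
    (hπ : π ∉ (PrimeSpectrum.comap (invol p).toRingHom 𝔮₀).asIdeal)
    (hXsym : lengthAt (IwasawaAlgebra p) D.X 𝔮₀ =
      lengthAt (IwasawaAlgebra p) D.X (PrimeSpectrum.comap (invol p).toRingHom 𝔮₀))
    (hLtι : (Ideal.span {Lt}).map (invol p).toRingHom = Ideal.span {Lt}) :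
    lengthAt (IwasawaAlgebra p) D.X 𝔮₀ ≤
      lengthAt (IwasawaAlgebra p) (IwasawaAlgebra p ⧸ Ideal.span {Lt}) 𝔮₀ := by
  set 𝔮' := PrimeSpectrum.comap (invol p).toRingHom 𝔮₀ with h𝔮'def
  have h𝔮' : 𝔮'.asIdeal.height = 1 := by rw [h𝔮'def, height_comap_invol]; exact h𝔮₀
  have hp𝔮' : PowerSeries.C (p : ℤ_[p]) ∉ 𝔮'.asIdeal := by
    intro h
    apply hp𝔮₀
    rw [h𝔮'def, PrimeSpectrum.comap_asIdeal, Ideal.mem_comap] at h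
    change invol p (PowerSeries.C (p : ℤ_[p])) ∈ 𝔮₀.asIdeal at h
    rwa [invol_C] at h
  have hA := K.lengthAt_X_le_off_factor h12 hκ hγ hLt hLt0 𝔮' h𝔮' hp𝔮' hπ
  rw [hXsym, lengthAt_quotient_span_eq_comap_invol_of_map_invol_span_eq hLtι 𝔮₀]
  exact hA

end Literature.NumberTheory.EllipticCurves.Kato2004

end
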